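/-
Copyright (c) 2026 the pub-hodgecm-mathlib formalisation cell (harness21).  Prover seat hodgecm-mathlib-K2E1b-p01 (g3),
Track B «K2-LIT» ∕ h413, line `K2_E1b_GKCohomologyU21`, file #22 (LEVEL B): the submodule lattice of Kovačević's
`V(c, 2t)` has EXACTLY ONE coatom, for every `(c, t)`.  2026-09-03.
-/
import Literature.RepresentationTheory.Kovacevic2021.SU21PrincipalSeriesSubmoduleLattice   -- ★ §2–§4: lower sets, classification, root-free bound
import HarnessLib

/-!
# K2_E1b road (h413 = stmt-HodgeConjecture-24833), file #22 «UNIQUE COATOM»: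
# every `V(c, 2t)` has exactly one maximal proper `𝔤𝔩(3, ℂ)`-submodule

Cell `pub/hodgecm-mathlib` (D-0151), Track B (21-frontier RULING «PUSH BOTH» 2026-09-03, director req624, SKELETON LANDED
K2E1b l.72387), line `Cruxes/H413/Lines/K2_E1b_GKCohomologyU21.lean` (planner K2E1b-plan), SIGS TABLE #22
`K2E1bUniqueCoatomOfOneRoot` (LEVEL B, `IsCoatom` in the lattice of `LieSubmodule`s of Kovačević's ★ `principalSeries c t`;
the card's motivation is [Rogawski1990, §12.3 p. 176] ∕ [BorelWallach2000, VI 4.10 (10)]).  Refuter K2E1b-r01 (g2) PRE-AUDIT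
2026-09-03T22:23Z: the right shape is HYPOTHESIS-FREE — the «one root» proviso is idle — and the rendering `∃! N, N ≠ ⊥ ∧ N ≠ ⊤` is
false at the cohomological points; this file proves the hypothesis-free statement.

THE MATHEMATICS.  By ★ `SU21PrincipalSeriesSubmoduleLattice` (Kovačević §3 Thm 3, Remark 6) the lattice of Lie submodules
`N ⊆ V(c,2t)` is isomorphic, via `N ↦ R_N = {(p,q) ∈ ℕ² : u¹_{(p,q)} ∈ N}`, to the lattice of lower sets `R ⊆ ℕ²` closed one
step to the right across every non-root of `a(p) = 2c − (p+1)t − p(p+2)` and one step up across every non-root of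
`b(q) = 2c + (q+1)t − q(q+2)`; and `a`, `b` have finitely many natural roots.  Put
`R₀ := {(p,q) : some natural root of a is ≥ p, or some natural root of b is ≥ q}` — the complement of the TOP CELL
`{p > every root of a} × {q > every root of b}` (non-empty by the root-free bound; the top cell is all of `ℕ²` when `V` is
irreducible, in which case `R₀ = ∅`).  Then (§1) a submodule meeting one `K`-type of the top cell is everything (all arrows
beyond the roots are live, then down-closure); (§2) `R₀` is admissible, so it is `R_{N₀}` for exactly one `N₀`, and
`N₀ ≠ ⊤`; hence every proper submodule lies in `N₀` (§3), i.e. **`N₀` is the greatest proper submodule: the unique coatom**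
(§4 `existsUnique_isCoatom`), and a submodule is THE coatom iff its `K`-types are exactly `R₀` (`isCoatom_iff`).  At the
three cohomological points: `(0,0)` — `R₀ = {p = 0} ∪ {q = 0}`, quotient `K`-types `{p ≥ 1} × {q ≥ 1}`; `(−3∕2, −3)` —
`R₀ = {p ≤ 1} × ℕ`, quotient `{p ≥ 2} × ℕ`; `(−3∕2, 3)` symmetric (r01's kernel-checked root census).  CAVEAT (K2E1b-r01 (g2)
ADDENDUM 2026-09-03T22:35Z, ★ `SU21PrincipalSeriesCompositionSeries` ∕ ★ `SU21HolomorphicCompositionFactors`): `V(c,2t)` is Kovačević's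
GLUED module (all down-arrows live, so every submodule is a lower set and the vertex `K`-type is in the socle), NOT the induced
standard module of Langlands theory in either orientation; at the cohomological points the unique irreducible QUOTIENT is the
middle discrete series `D_1` (`midDS`) and `J^±` is the MIDDLE composition factor — so this file is the lattice statement
«unique maximal proper submodule of `V(c,2t)`», and must not be read as print's «`J^±` is the Langlands quotient».

* §1 `eq_top_of_vec_one_mem_of_rootFree` — a submodule meeting a root-free `K`-type is `⊤`.
* §2 `isLowerSet_subTop`, `existsUnique_lieSubmodule_subTop` — `R₀` is admissible; the submodule `N₀` with `R_{N₀} = R₀`.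
* §3 `ne_top_of_forall_iff_subTop`, `le_of_ne_top`, `isCoatom_of_forall_iff_subTop` — `N₀` is the greatest proper submodule.
* §4 **`existsUnique_isCoatom`** (`∀ c t, ∃! N, IsCoatom N`) and **`isCoatom_iff`** (the coatom's `K`-types are `R₀`).

THEOREMS ONLY (no definition ∕ instance ∕ notation ∕ named fact ∕ `sorry`); imports one ★ Literature module.
HONEST LABEL: HC_CM is proved only modulo the 7 printed citations (2 remaining named inputs: hLiu418 =
stmt-HodgeConjecture-24832, h413 = stmt-HodgeConjecture-24833) until rung 0 closes; this file is a
`--supports stmt-HodgeConjecture-24833 --as helper` leaf (Level-B rung of the K2_E1b road) and retires nothing by itself.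

## References
* [Kovacevic2021] D. Kovačević, *Unitary `(𝔤,K)` modules of `SU(2,1)`*, Acta Math. Spalatensia 1 (2021) 105–125
  (arXiv:1810.01752), §3 Thm 3 (proof) and Remark 6.
* [BorelWallach2000] A. Borel, N. Wallach, *Continuous cohomology, discrete subgroups, and representations of reductive
  groups*, 2nd ed. (2000), VI 4.10 (10) p. 132.
* [Rogawski1990] J. D. Rogawski, *Automorphic Representations of Unitary Groups in Three Variables*, Ann. of Math. Stud. 123
  (1990), §12.3 pp. 176–177.
-/

set_option autoImplicit false
set_option linter.dupNamespace false   -- `Summit.HodgeConjecture.HodgeConjecture.…` (D-0017 nested layout; lakefile exemption for Summits)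

namespace Summit.HodgeConjecture.HodgeConjecture.Cruxes.H413.K2E1bUniqueCoatomOfOneRoot

open Literature.RepresentationTheory.Kovacevic2021
open Literature.RepresentationTheory.Kovacevic2021.SU21Datum
open Literature.RepresentationTheory.Kovacevic2021.SU21Datum.PrincipalSeries

-- Mathlib idiom (Mathlib/Algebra/Lie/OfAssociative.lean), as in every ★ `Kovacevic2021` module: commutator brackets on
-- `𝔤𝔩(3, ℂ) = Matrix (Fin 3) (Fin 3) ℂ`, needed to speak of `LieSubmodule ℂ (Matrix (Fin 3) (Fin 3) ℂ) (principalSeries c t).V`.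
attribute [local instance 100] LieRing.ofAssociativeRing

variable (c : ℂ) (t : ℤ)

/-! ## §1  A submodule meeting a `K`-type of the top cell is everything -/

/-- **Beyond the roots every arrow is live.**  If a Lie submodule `N ⊆ V(c,2t)` contains `u¹_{(p,q)}` with NO natural
root of `a` at or beyond `p` and none of `b` at or beyond `q`, then `N = ⊤`: up-moves from `(p,q)` reach every
`(p+d, q+e)` (★ `principalSeries_vec_one_mem_up_p∕_q`), and the `K`-type set is a lower set (★ `principalSeries_isLowerSet`).
[cite: Kovacevic2021, §3 Thm 3 (proof) and Remark 6] -/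
theorem eq_top_of_vec_one_mem_of_rootFree (N : LieSubmodule ℂ (Matrix (Fin 3) (Fin 3) ℂ) (principalSeries c t).V)
    {p q : ℕ} (h : (principalSeries c t).vec (1 + (p : ℤ) + q) (2 * t + 3 * (p : ℤ) - 3 * q) 1 ∈ N)
    (ha : ∀ r : ℕ, p ≤ r → acoef c t r ≠ 0) (hb : ∀ s : ℕ, q ≤ s → bcoef c t s ≠ 0) : N = ⊤ := by
  -- every `K`-type `(p + d, q + e)` is met
  have key : ∀ d e : ℕ, (principalSeries c t).vec (1 + ((p + d : ℕ) : ℤ) + ((q + e : ℕ) : ℤ))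
      (2 * t + 3 * ((p + d : ℕ) : ℤ) - 3 * ((q + e : ℕ) : ℤ)) 1 ∈ N := by
    intro d e
    have h1 := principalSeries_vec_one_mem_up_p N (p := (p : ℤ)) (q := (q : ℤ)) (by positivity) (by positivity) d h
      (fun r hr _ => by
        obtain ⟨r', rfl⟩ := Int.eq_ofNat_of_zero_le (by omega : (0 : ℤ) ≤ r)
        exact ha r' (by exact_mod_cast hr))
    have h2 := principalSeries_vec_one_mem_up_q N (p := (p : ℤ) + d) (q := (q : ℤ)) (by positivity) (by positivity) e
      h1 (fun s hs _ => by
        obtain ⟨s', rfl⟩ := Int.eq_ofNat_of_zero_le (by omega : (0 : ℤ) ≤ s)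
        exact hb s' (by exact_mod_cast hs))
    convert h2 using 2 <;> push_cast <;> ring
  -- hence every `K`-type `(p', q') ≤ (p + p', q + q')` is met, i.e. `⊤ ≤ N`
  refine eq_top_iff.2 ((principalSeries_le_iff_forall_nat ⊤ N).2 fun p' q' _ => ?_)
  have hle : ((p', q') : ℕ × ℕ) ≤ (p + p', q + q') := ⟨Nat.le_add_left _ _, Nat.le_add_left _ _⟩
  exact principalSeries_isLowerSet N hle (key p' q')

/-! ## §2  The complement `R₀` of the top cell is admissible: the submodule `N₀` -/

/-- **`R₀ = {(p,q) : ∃ root r ≥ p of a, or ∃ root s ≥ q of b}` is a lower set of `ℕ × ℕ`.**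
[cite: Kovacevic2021, §3 Thm 3 (proof) and Remark 6] -/
theorem isLowerSet_subTop :
    IsLowerSet {x : ℕ × ℕ | (∃ r : ℕ, x.1 ≤ r ∧ acoef c t r = 0) ∨ (∃ s : ℕ, x.2 ≤ s ∧ bcoef c t s = 0)} := by
  rintro ⟨p, q⟩ ⟨p', q'⟩ ⟨hpp, hqq⟩ h
  simp only [Set.mem_setOf_eq] at h ⊢
  rcases h with ⟨r, hr, h0⟩ | ⟨s, hs, h0⟩
  · exact Or.inl ⟨r, le_trans hpp hr, h0⟩
  · exact Or.inr ⟨s, le_trans hqq hs, h0⟩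

/-- **The submodule below the top cell.**  `R₀` is a lower set closed one step to the right across every non-root of `a`
(if `(p,q) ∈ R₀` via a root `r ≥ p` of `a` and `a(p) ≠ 0` then `r ≥ p + 1`) and one step up across every non-root of `b`;
so by Kovačević's classification (★ `principalSeries_existsUnique_lieSubmodule`) there is EXACTLY ONE Lie submodule
`N₀ ⊆ V(c,2t)` whose `K`-types are `R₀`: `u¹_{(p,q)} ∈ N₀ ↔ (p,q) ∈ R₀`.
[cite: Kovacevic2021, §3 Thm 3 (proof) and Remark 6] -/
theorem existsUnique_lieSubmodule_subTop :
    ∃! N : LieSubmodule ℂ (Matrix (Fin 3) (Fin 3) ℂ) (principalSeries c t).V,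
      ∀ p q : ℕ, (principalSeries c t).vec (1 + (p : ℤ) + q) (2 * t + 3 * (p : ℤ) - 3 * q) 1 ∈ N ↔
        ((∃ r : ℕ, p ≤ r ∧ acoef c t r = 0) ∨ (∃ s : ℕ, q ≤ s ∧ bcoef c t s = 0)) := by
  have hex := principalSeries_existsUnique_lieSubmodule c t
    (R := {x : ℕ × ℕ | (∃ r : ℕ, x.1 ≤ r ∧ acoef c t r = 0) ∨ (∃ s : ℕ, x.2 ≤ s ∧ bcoef c t s = 0)})
    (isLowerSet_subTop c t)
    (fun p q h ha => by
      simp only [Set.mem_setOf_eq] at h ⊢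
      rcases h with ⟨r, hr, h0⟩ | hs
      · refine Or.inl ⟨r, ?_, h0⟩
        rcases hr.eq_or_lt with rfl | hlt
        · exact absurd h0 ha
        · exact hlt
      · exact Or.inr hs)
    (fun p q h hb => by
      simp only [Set.mem_setOf_eq] at h ⊢
      rcases h with hr | ⟨s, hs, h0⟩
      · exact Or.inl hr
      · refine Or.inr ⟨s, ?_, h0⟩
        rcases hs.eq_or_lt with rfl | hlt
        · exact absurd h0 hb
        · exact hlt)
  simpa only [Set.mem_setOf_eq] using hex

/-! ## §3  `N₀` is the greatest proper submodule -/

/-- **`N₀ ≠ ⊤`**: a root-free corner `(B, B)` (★ `principalSeries_exists_rootFree_bound`) lies outside `R₀` but its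
`K`-type is met by `⊤`. [cite: Kovacevic2021, §3 Thm 3 (proof) and Remark 6] -/
theorem ne_top_of_forall_iff_subTop (N : LieSubmodule ℂ (Matrix (Fin 3) (Fin 3) ℂ) (principalSeries c t).V)
    (hN : ∀ p q : ℕ, (principalSeries c t).vec (1 + (p : ℤ) + q) (2 * t + 3 * (p : ℤ) - 3 * q) 1 ∈ N ↔
      ((∃ r : ℕ, p ≤ r ∧ acoef c t r = 0) ∨ (∃ s : ℕ, q ≤ s ∧ bcoef c t s = 0))) : N ≠ ⊤ := by
  obtain ⟨B, hBa, hBb⟩ := principalSeries_exists_rootFree_bound c t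
  intro h
  have hmem : (principalSeries c t).vec (1 + (B : ℤ) + B) (2 * t + 3 * (B : ℤ) - 3 * B) 1 ∈ N := by
    rw [h]
    exact LieSubmodule.mem_top _
  rcases (hN B B).1 hmem with ⟨r, hr, h0⟩ | ⟨s, hs, h0⟩
  · exact absurd (hBa r h0) (not_lt.2 hr)
  · exact absurd (hBb s h0) (not_lt.2 hs)

/-- **Every proper Lie submodule of `V(c,2t)` lies in `N₀`**: a `K`-type of a proper submodule cannot lie in the top
cell (§1), so it lies in `R₀ = R_{N₀}`; conclude by ★ `principalSeries_le_iff_forall_nat`.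
[cite: Kovacevic2021, §3 Thm 3 (proof) and Remark 6] -/
theorem le_of_ne_top (N₀ : LieSubmodule ℂ (Matrix (Fin 3) (Fin 3) ℂ) (principalSeries c t).V)
    (hN₀ : ∀ p q : ℕ, (principalSeries c t).vec (1 + (p : ℤ) + q) (2 * t + 3 * (p : ℤ) - 3 * q) 1 ∈ N₀ ↔
      ((∃ r : ℕ, p ≤ r ∧ acoef c t r = 0) ∨ (∃ s : ℕ, q ≤ s ∧ bcoef c t s = 0)))
    (N : LieSubmodule ℂ (Matrix (Fin 3) (Fin 3) ℂ) (principalSeries c t).V) (hN : N ≠ ⊤) : N ≤ N₀ := by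
  refine (principalSeries_le_iff_forall_nat N N₀).2 fun p q h => (hN₀ p q).2 ?_
  by_contra hpq
  simp only [not_or, not_exists, not_and] at hpq
  exact hN (eq_top_of_vec_one_mem_of_rootFree c t N h (fun r hr => hpq.1 r hr) (fun s hs => hpq.2 s hs))

/-- **`N₀` is a coatom** (a maximal proper Lie submodule): `N₀ ≠ ⊤`, and `N₀ < N` forces `N = ⊤` since otherwise
`N ≤ N₀`. [cite: Kovacevic2021, §3 Thm 3 (proof) and Remark 6] [cite: BorelWallach2000, VI 4.10 (10) p. 132] -/
theorem isCoatom_of_forall_iff_subTop (N₀ : LieSubmodule ℂ (Matrix (Fin 3) (Fin 3) ℂ) (principalSeries c t).V)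
    (hN₀ : ∀ p q : ℕ, (principalSeries c t).vec (1 + (p : ℤ) + q) (2 * t + 3 * (p : ℤ) - 3 * q) 1 ∈ N₀ ↔
      ((∃ r : ℕ, p ≤ r ∧ acoef c t r = 0) ∨ (∃ s : ℕ, q ≤ s ∧ bcoef c t s = 0))) : IsCoatom N₀ := by
  refine ⟨ne_top_of_forall_iff_subTop c t N₀ hN₀, fun N hlt => ?_⟩
  by_contra hN
  exact lt_irrefl N₀ (lt_of_lt_of_le hlt (le_of_ne_top c t N₀ hN₀ N hN))

/-! ## §4  The unique coatom -/

/-- **UNIQUE COATOM (hypothesis-free).**  For EVERY `c ∈ ℂ`, `t ∈ ℤ`, Kovačević's principal-series `𝔤𝔩(3, ℂ)`-module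
`V(c, 2t)` has exactly one maximal proper Lie submodule — the submodule `N₀` whose `K`-types are the complement `R₀` of the
top cell (`N₀ = ⊥` when `V(c,2t)` is irreducible); equivalently `V(c,2t)` has a unique irreducible quotient, whose
`K`-types form the top cell `{p > every natural root of a} × {q > every natural root of b}` (at the cohomological points
`(0,0)`, `(−3∕2, ±3)`: the middle discrete series `D_1`; `J^±` is the middle composition factor, NOT this quotient — see the
module docstring's CAVEAT). [cite: Kovacevic2021, §3 Thm 3 (proof) and Remark 6] [cite: BorelWallach2000, VI 4.10 (10) p. 132] -/
theorem existsUnique_isCoatom :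
    ∃! N : LieSubmodule ℂ (Matrix (Fin 3) (Fin 3) ℂ) (principalSeries c t).V, IsCoatom N := by
  obtain ⟨N₀, hN₀, -⟩ := existsUnique_lieSubmodule_subTop c t
  refine ⟨N₀, isCoatom_of_forall_iff_subTop c t N₀ hN₀, fun N hN => ?_⟩
  rcases (le_of_ne_top c t N₀ hN₀ N hN.1).eq_or_lt with h | h
  · exact h
  · exact absurd (hN.2 N₀ h) (ne_top_of_forall_iff_subTop c t N₀ hN₀)

/-- **The coatom in `K`-type coordinates.**  A Lie submodule `N ⊆ V(c,2t)` is THE coatom iff its `K`-types are exactly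
`R₀`: `u¹_{(p,q)} ∈ N ↔ (some natural root of a is ≥ p) ∨ (some natural root of b is ≥ q)`.  (So the irreducible quotient
`V∕N` carries exactly the `K`-types of the top cell.) [cite: Kovacevic2021, §3 Thm 3 (proof) and Remark 6] [cite: BorelWallach2000, VI 4.10 (10) p. 132] -/
theorem isCoatom_iff (N : LieSubmodule ℂ (Matrix (Fin 3) (Fin 3) ℂ) (principalSeries c t).V) :
    IsCoatom N ↔ ∀ p q : ℕ, ((principalSeries c t).vec (1 + (p : ℤ) + q) (2 * t + 3 * (p : ℤ) - 3 * q) 1 ∈ N ↔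
      ((∃ r : ℕ, p ≤ r ∧ acoef c t r = 0) ∨ (∃ s : ℕ, q ≤ s ∧ bcoef c t s = 0))) := by
  refine ⟨fun hN => ?_, isCoatom_of_forall_iff_subTop c t N⟩
  obtain ⟨N₀, hN₀, -⟩ := existsUnique_lieSubmodule_subTop c t
  obtain rfl : N = N₀ :=
    (existsUnique_isCoatom c t).unique hN (isCoatom_of_forall_iff_subTop c t N₀ hN₀)
  exact hN₀

end Summit.HodgeConjecture.HodgeConjecture.Cruxes.H413.K2E1bUniqueCoatomOfOneRoot
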